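import Summits.HodgeConjecture.CorCM.DecicCurveFivefoldPowersTransfer
import Summits.HodgeConjecture.CorCM.DecicCurveFivefoldWeilAiming
import Summits.HodgeConjecture.CorCM.BiproductSlotsDomination
import HarnessLib

/-!
# COR-CM — the Hodge conjecture for ALL PRODUCTS OF COPIES `B₀^a × E^c` of the half-circle CM fivefold of a cyclic decic
# CM field `F ⊃ k` and the CM curve of `k`, GIVEN MARKMAN'S HYPERBOLIC-SIXFOLD THEOREM ONLY (frame form)

Cell `pub-hodgecm2` (COR-CM), seat b09 gen 18 (2026-08-21); count-neutral own lane DECIC-EB0 = lit-andre-3's prover-lane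
ask A6-R22 «`CorCM/` THEOREM HC(E^a × B₀^b) for cyclic decic F on the real carriers» (PORTFOLIO-lit-andre-3-g10 §0 (5a),
§6); theorems only, no definition, no named fact, no `sorry`.  HONEST FRAMING: CONDITIONAL on the single displayed named
fact `HodgeTheory.Markman2025_weilClasses_algebraic_hyperbolicSixfold` (E. Markman, arXiv:2502.03415 Thm 1.5.1 —
UNREFEREED); `HC_CM` is not asserted and no case of the Hodge conjecture is claimed unconditionally.

ASSEMBLY of
* `CorCM/DecicCurveFivefoldPowersTransfer.lean` — `HodgeConjectureFor (⨁_j A₂ (κ j))` for every slot map `κ`, GIVEN the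
  Weil plane of the sixfold `(B₀ × E, ι_B(iδ) × ι_E(δ))` (kernel census `Census/DecicCurveFivefold*`: the `{B₀, E}`
  sub-slice has ONE atom, the `k`-Weil `6`-set; seat b30's distribution lemma), and
* `CorCM/DecicCurveFivefoldWeilAiming.lean` — that Weil plane is algebraic GIVEN Markman's theorem (Weil type `(3,3)` from
  the type count; split polarisation by ring 2's `isSplitWeilType_odd_prod_curve`),
with the TYPE COUNT `#{s ∈ Φ : s ∘ i = τ'} + [τ' ∈ {τ}] = 3` READ OFF THE FRAME (`typeCount_eq_three_of_frame`: in a cyclic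
frame `e : Hom(F, ℂ) ≃ ℤ/10` with `Φ = {e s < 5}` and `s|_k = τ ⟺ e s odd`, the fibre of `τ` meets `Φ` in `{1, 3}` and the
fibre of `τ̄` in `{0, 2, 4}`).

MAIN THEOREM `hodgeConjectureFor_biproduct_comp_of_frame_of_markmanSixfold`: `k = Kf i₀` imaginary quadratic (`δ² = -d`,
`τ(δ) = i√d`), `F = Kf i₁ ⊇ i(k)` of degree `10` read in a cyclic frame (`he_sign`, `he_conj`, `he_gal`),
`B₀ = A₂ 0 ⊨ (F; {s | e s < 5})`, `E = A₂ 1 ⊨ (k; {τ})`: for every `κ : Fin N → Fin 2` every rational `(p,p)`-class on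
`⨁_j A₂ (κ j)` — i.e. on `B₀^a × E^c`, all `a, c`, any order — is algebraic, GIVEN ONLY Markman's sixfold theorem; with the
`AVDominatedBy`, isogenous-product and all-powers forms.  The intrinsic form (Galois decic `F`, a generator `σ` of
`Gal(F/ℚ)`, `Φ = {p ∘ σⁿ : n < 5}`; no frame, no `Aut(ℂ)` data) is the sequel `CorCM/DecicCurveFivefoldHodgeOfMarkmanCyclic.lean`.
WHAT IS NEW IN PRINT (lit-andre-3 PORTFOLIO-g10 §0 (5a), modulo Markman): e.g. `E × B₀` for `E` with CM by `ℚ(√-31)` and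
`B₀` in the `K₃₁`-slice — a CM sixfold on which only divisors were known — and all `B₀^a × E^c`.
[cite: Markman2025SecantWeil, Thm 1.5.1] [cite: Pohlmann1968, Thm 1] [cite: Deligne1982HodgeCycles, §4–§5]
[cite: MoonenZarhin1999LowDim, Thm. 0.1 (a)] [cite: vanGeemen1994HodgeAV, 4.9, 5.2–5.4] [cite: MumfordAV1970, §19]

## References
* [Markman2025SecantWeil] E. Markman, arXiv:2502.03415 (unrefereed), Thm 1.5.1.  [Pohlmann1968] Ann. of Math. 88, Thm 1.
  [Deligne1982HodgeCycles] LNM 900, §4 Prop. 4.4, §5 (c).  [MoonenZarhin1999LowDim] Math. Ann. 315, Thm. 0.1 (a).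
  [vanGeemen1994HodgeAV] LNM 1594, 4.9, Lemma 5.2, 5.4.  [MumfordAV1970] §19.  [GaoUllmo2025] J. Inst. Math. Jussieu 25, Thm 3.1.
-/

noncomputable section

open CategoryTheory CategoryTheory.Limits NumberField

namespace Summit.HodgeConjecture.CorCM.DecicCurveFivefold

open Literature.AlgebraicGeometry Literature.AlgebraicGeometry.Motives Literature.AlgebraicGeometry.HodgeTheory
open Literature.AlgebraicGeometry.ComplexMultiplication (IsCMTypeRealisation)
open Summit.HodgeConjecture.CorCM.DihedralSexticPair (card_filter_equiv_mem eq_or_eq_conjugate)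

open scoped Classical

/-! ## §1 The type count read off the frame -/

section Count

variable {I : Type} {Kf : I → Type} [∀ i, Field (Kf i)] [∀ i, NumberField (Kf i)] {i₀ i₁ : I}
  {e : (Kf i₁ →+* ℂ) ≃ ZMod 10} {τ : Kf i₀ →+* ℂ} {i : Kf i₀ →+* Kf i₁}

/-- The finite facts: in `ℤ/10`, the odd residues below `5` are `{1, 3}` (two of them) and the even ones `{0, 2, 4}`
(three). [folklore] -/
theorem card_halfCircle_parity :
    ((Finset.univ : Finset (ZMod 10)).filter fun j => j.val % 2 = 1 ∧ j.val < 5).card = 2 ∧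
    ((Finset.univ : Finset (ZMod 10)).filter fun j => ¬ j.val % 2 = 1 ∧ j.val < 5).card = 3 := by
  refine ⟨by decide, by decide⟩

/-- **The type count `(2 + 1, 3 + 0) = (3, 3)` read off the frame**: for `Φ = {s | e s < 5}`, `Ψ = {τ}` and
`s|_k = τ ⟺ e s` odd, every complex embedding `τ'` of `k` has `#{s ∈ Φ : s ∘ i = τ'} + [τ' ∈ Ψ] = 3` — the Weil-type
condition of `isWeilType_cmFivefold_prod_cmCurve` (multiplicities `(3,3)` of `k` on `H^{1,0}(B₀ × E)`).
[cite: Deligne1982HodgeCycles, §5 (c)] [cite: MoonenZarhin1998WeilClasses, §1] -/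
theorem typeCount_eq_three_of_frame (h2 : Module.finrank ℚ (Kf i₀) = 2) {δ : 𝓞 (Kf i₀)} {d : ℕ} (hd : 0 < d)
    (hτ : τ (δ : Kf i₀) = Complex.I * (Real.sqrt d : ℂ))
    (he_sign : ∀ s : Kf i₁ →+* ℂ, s.comp i = τ ↔ (e s).val % 2 = 1)
    {Φ : CMType (Kf i₁)} (hΦ : ∀ s : Kf i₁ →+* ℂ, s ∈ Φ.1 ↔ (e s).val < 5)
    {Ψ : CMType (Kf i₀)} (hΨ : ∀ σ : Kf i₀ →+* ℂ, σ ∈ Ψ.1 ↔ σ = τ) (τ' : Kf i₀ →+* ℂ) :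
    (Finset.univ.filter fun s : Kf i₁ →+* ℂ => s.comp i = τ' ∧ s ∈ Φ.1).card + (if τ' ∈ Ψ.1 then 1 else 0) = 3 := by
  have hττ : ComplexEmbedding.conjugate τ ≠ τ := CMThreefoldPair.conjugate_ne_of_apply_eq hd hτ
  rcases eq_or_eq_conjugate h2 hd hτ τ' with rfl | rfl
  · rw [if_pos ((hΨ τ').2 rfl)]
    have hfilter : (Finset.univ.filter fun s : Kf i₁ →+* ℂ => s.comp i = τ' ∧ s ∈ Φ.1) =
        Finset.univ.filter fun s => e s ∈
          ((Finset.univ : Finset (ZMod 10)).filter fun j => j.val % 2 = 1 ∧ j.val < 5) := by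
      refine Finset.filter_congr fun s _ => ?_
      rw [he_sign, hΦ s, Finset.mem_filter]
      exact ⟨fun h => ⟨Finset.mem_univ _, h⟩, fun h => h.2⟩
    rw [hfilter, card_filter_equiv_mem, card_halfCircle_parity.1]
  · have hnot : ComplexEmbedding.conjugate τ ∉ Ψ.1 := fun h => hττ ((hΨ _).1 h)
    rw [if_neg hnot, add_zero]
    have hfilter : (Finset.univ.filter fun s : Kf i₁ →+* ℂ => s.comp i = ComplexEmbedding.conjugate τ ∧ s ∈ Φ.1) =
        Finset.univ.filter fun s => e s ∈
          ((Finset.univ : Finset (ZMod 10)).filter fun j => ¬ j.val % 2 = 1 ∧ j.val < 5) := by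
      refine Finset.filter_congr fun s _ => ?_
      rw [hΦ s, Finset.mem_filter]
      constructor
      · rintro ⟨h1, h3⟩
        refine ⟨Finset.mem_univ _, fun hodd => ?_, h3⟩
        exact hττ (h1 ▸ ((he_sign s).2 hodd) ▸ rfl)
      · rintro ⟨-, h1, h3⟩
        exact ⟨comp_eq_conjugate_of_even (fun σ => eq_or_eq_conjugate h2 hd hτ σ) he_sign h1, h3⟩
    rw [hfilter, card_filter_equiv_mem, card_halfCircle_parity.2]

end Count

/-! ## §2 The main theorem: frame form, Markman's sixfold theorem the only leaf -/

section Main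

variable {I : Type} {Kf : I → Type} [∀ i, Field (Kf i)] [∀ i, NumberField (Kf i)] [∀ i, IsCMField (Kf i)]
  {i₀ i₁ : I} {N : ℕ} {τ : Kf i₀ →+* ℂ}
  {A₂ : Fin 2 → AbelianVariety ℂ} {Φ₂ : ∀ j : Fin 2, CMType (Kf (curveSlots₂ i₀ i₁ j))}
  {ι₂ : ∀ j, 𝓞 (Kf (curveSlots₂ i₀ i₁ j)) →+* End (A₂ j)}
  {θ₂ : ∀ j, Kf (curveSlots₂ i₀ i₁ j) →+* Module.End ℂ (complexBetti (A₂ j).X 1)}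

/-- **MAIN THEOREM (frame form).  The Hodge conjecture for every power `⨁_j A₂(κ j)` of `B₀ × E` — i.e. for
`B₀^a × E^c`, all `a, c`, any order — GIVEN ONLY Markman's hyperbolic-sixfold theorem.**  `k = Kf i₀` imaginary quadratic
(`[k:ℚ] = 2`, `δ² = -d`, `τ(δ) = i√d`), `F = Kf i₁ ⊇ i(k)` of degree `10` read in a cyclic frame `e : Hom(F, ℂ) ≃ ℤ/10`
(`he_sign`: `s|_k = τ ⟺ e s` odd; `he_conj`: conjugation is `+5`; `he_gal`: every translation is realised by an
automorphism of `ℂ`), `A₂ 0 ⊨ (F; {s | e s < 5})` (the half-circle CM fivefold `B₀`), `A₂ 1 ⊨ (k; {τ})` (the CM curve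
`E`): every rational `(p,p)`-class on `⨁_j A₂ (κ j)` is algebraic, for every slot map `κ : Fin N → Fin 2` and every `p`.
Leaves: `Markman2025_weilClasses_algebraic_hyperbolicSixfold` ONLY (the Weil plane of `B₀ × E` by
`weilClassesOf_le_algebraicClasses_cmFivefold_prod_cmCurve_of_markmanSixfold`; everything else by
`hodgeConjectureFor_biproduct_comp_of_weilPlane`). [cite: Markman2025SecantWeil, Thm 1.5.1] [cite: Pohlmann1968, Thm 1]
[cite: Deligne1982HodgeCycles, §4 Prop. 4.4 and §5 (c)] [cite: MoonenZarhin1999LowDim, Thm. 0.1 (a)]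
[cite: vanGeemen1994HodgeAV, 4.9 and (5.4.1)] -/
theorem hodgeConjectureFor_biproduct_comp_of_frame_of_markmanSixfold
    (hM : Markman2025_weilClasses_algebraic_hyperbolicSixfold) (κ : Fin N → Fin 2)
    (h10 : Module.finrank ℚ (Kf i₁) = 10) (h2 : Module.finrank ℚ (Kf i₀) = 2) (i : Kf i₀ →+* Kf i₁)
    {δ : 𝓞 (Kf i₀)} {d : ℕ} (hd : 0 < d) (hδ : ((δ : Kf i₀)) ^ 2 = -(d : Kf i₀))
    (hτ : τ (δ : Kf i₀) = Complex.I * (Real.sqrt d : ℂ))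
    (hA : ∀ j, IsCMTypeRealisation (Φ₂ j) (A₂ j) (ι₂ j) (θ₂ j))
    (e : (Kf i₁ →+* ℂ) ≃ ZMod 10)
    (he_sign : ∀ s : Kf i₁ →+* ℂ, s.comp i = τ ↔ (e s).val % 2 = 1)
    (he_conj : ∀ s : Kf i₁ →+* ℂ, e (ComplexEmbedding.conjugate s) = e s + 5)
    (he_gal : ∀ g : ZMod 10, ∃ ρ : ℂ ≃+* ℂ, ∀ s : Kf i₁ →+* ℂ, e ((ρ : ℂ →+* ℂ).comp s) = e s + g)
    (hΦ : ∀ s : Kf i₁ →+* ℂ, s ∈ (Φ₂ 0).1 ↔ (e s).val < 5)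
    (hΨ : ∀ σ : Kf i₀ →+* ℂ, σ ∈ (Φ₂ (0 : Fin 1).succ).1 ↔ σ = τ) :
    HodgeConjectureFor (⨁ fun j => A₂ (κ j)).dim (⨁ fun j => A₂ (κ j)).X :=
  hodgeConjectureFor_biproduct_comp_of_weilPlane κ h2 i hd hτ hA e he_sign he_conj he_gal hΦ hΨ
    (weilClassesOf_le_algebraicClasses_cmFivefold_prod_cmCurve_of_markmanSixfold hM h10 h2 i (hA 0)
      (hA (0 : Fin 1).succ) hd hδ (typeCount_eq_three_of_frame h2 hd hτ he_sign hΦ hΨ))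

/-- **The Hodge conjecture for every abelian variety dominated by a power `⨁_j A₂(κ j)`** (frame form, modulo Markman's
sixfold theorem): every abelian variety isogenous to a product of copies of `B₀`, `E` and their abelian subvarieties and
quotients. [cite: Markman2025SecantWeil, Thm 1.5.1] [cite: MumfordAV1970, §19] -/
theorem hodgeConjectureFor_of_avDominatedBy_comp_of_frame_of_markmanSixfold
    (hM : Markman2025_weilClasses_algebraic_hyperbolicSixfold) (κ : Fin N → Fin 2)
    (h10 : Module.finrank ℚ (Kf i₁) = 10) (h2 : Module.finrank ℚ (Kf i₀) = 2) (i : Kf i₀ →+* Kf i₁)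
    {δ : 𝓞 (Kf i₀)} {d : ℕ} (hd : 0 < d) (hδ : ((δ : Kf i₀)) ^ 2 = -(d : Kf i₀))
    (hτ : τ (δ : Kf i₀) = Complex.I * (Real.sqrt d : ℂ))
    (hA : ∀ j, IsCMTypeRealisation (Φ₂ j) (A₂ j) (ι₂ j) (θ₂ j))
    (e : (Kf i₁ →+* ℂ) ≃ ZMod 10)
    (he_sign : ∀ s : Kf i₁ →+* ℂ, s.comp i = τ ↔ (e s).val % 2 = 1)
    (he_conj : ∀ s : Kf i₁ →+* ℂ, e (ComplexEmbedding.conjugate s) = e s + 5)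
    (he_gal : ∀ g : ZMod 10, ∃ ρ : ℂ ≃+* ℂ, ∀ s : Kf i₁ →+* ℂ, e ((ρ : ℂ →+* ℂ).comp s) = e s + g)
    (hΦ : ∀ s : Kf i₁ →+* ℂ, s ∈ (Φ₂ 0).1 ↔ (e s).val < 5)
    (hΨ : ∀ σ : Kf i₀ →+* ℂ, σ ∈ (Φ₂ (0 : Fin 1).succ).1 ↔ σ = τ)
    {X : AbelianVariety ℂ} (hX : Domination.AVDominatedBy X (⨁ fun j => A₂ (κ j))) :
    HodgeConjectureFor X.dim X.X :=
  Domination.hodgeConjectureFor_of_avDominatedBy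
    (hodgeConjectureFor_biproduct_comp_of_frame_of_markmanSixfold hM κ h10 h2 i hd hδ hτ hA e he_sign he_conj he_gal hΦ
      hΨ) hX

/-- **… for every abelian variety ISOGENOUS TO A PRODUCT OF COPIES of `B₀` and `E`** (any finite index type), frame form,
modulo Markman's sixfold theorem. [cite: Markman2025SecantWeil, Thm 1.5.1] [cite: MumfordAV1970, §19] -/
theorem hodgeConjectureFor_of_isIsogenous_biproduct_of_frame_of_markmanSixfold
    (hM : Markman2025_weilClasses_algebraic_hyperbolicSixfold)
    (h10 : Module.finrank ℚ (Kf i₁) = 10) (h2 : Module.finrank ℚ (Kf i₀) = 2) (i : Kf i₀ →+* Kf i₁)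
    {δ : 𝓞 (Kf i₀)} {d : ℕ} (hd : 0 < d) (hδ : ((δ : Kf i₀)) ^ 2 = -(d : Kf i₀))
    (hτ : τ (δ : Kf i₀) = Complex.I * (Real.sqrt d : ℂ))
    (hA : ∀ j, IsCMTypeRealisation (Φ₂ j) (A₂ j) (ι₂ j) (θ₂ j))
    (e : (Kf i₁ →+* ℂ) ≃ ZMod 10)
    (he_sign : ∀ s : Kf i₁ →+* ℂ, s.comp i = τ ↔ (e s).val % 2 = 1)
    (he_conj : ∀ s : Kf i₁ →+* ℂ, e (ComplexEmbedding.conjugate s) = e s + 5)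
    (he_gal : ∀ g : ZMod 10, ∃ ρ : ℂ ≃+* ℂ, ∀ s : Kf i₁ →+* ℂ, e ((ρ : ℂ →+* ℂ).comp s) = e s + g)
    (hΦ : ∀ s : Kf i₁ →+* ℂ, s ∈ (Φ₂ 0).1 ↔ (e s).val < 5)
    (hΨ : ∀ σ : Kf i₀ →+* ℂ, σ ∈ (Φ₂ (0 : Fin 1).succ).1 ↔ σ = τ)
    {J : Type} [Fintype J] (cls : J → Fin 2) {X : AbelianVariety ℂ}
    (hX : AbelianVariety.IsIsogenous X (⨁ fun j => A₂ (cls j))) :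
    HodgeConjectureFor X.dim X.X := by
  classical
  let ε : Fin (Fintype.card J) ≃ J := (Fintype.equivFin J).symm
  have eJ : (⨁ fun j => A₂ (cls j)) ≅ ⨁ fun l => A₂ (cls (ε l)) := (biproduct.reindex ε fun j => A₂ (cls j)).symm
  exact hodgeConjectureFor_of_avDominatedBy_comp_of_frame_of_markmanSixfold hM (fun l => cls (ε l)) h10 h2 i hd hδ hτ hA e
    he_sign he_conj he_gal hΦ hΨ
    (Domination.AVDominatedBy.of_isIsogenous hX ((Domination.AVDominatedBy.refl _).of_iso_right eJ))

/-- **… and for ALL POWERS of such an abelian variety** (`X ∼ ⨁_{j : J} A₂ (cls j)` ⟹ `HC(X^{M+1})` for all `M`), frame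
form, modulo Markman's sixfold theorem. [cite: Markman2025SecantWeil, Thm 1.5.1] [cite: Gordon1999HodgeAVSurvey, 7.6.1] -/
theorem hodgeConjectureFor_powSucc_of_isIsogenous_biproduct_of_frame_of_markmanSixfold
    (hM : Markman2025_weilClasses_algebraic_hyperbolicSixfold)
    (h10 : Module.finrank ℚ (Kf i₁) = 10) (h2 : Module.finrank ℚ (Kf i₀) = 2) (i : Kf i₀ →+* Kf i₁)
    {δ : 𝓞 (Kf i₀)} {d : ℕ} (hd : 0 < d) (hδ : ((δ : Kf i₀)) ^ 2 = -(d : Kf i₀))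
    (hτ : τ (δ : Kf i₀) = Complex.I * (Real.sqrt d : ℂ))
    (hA : ∀ j, IsCMTypeRealisation (Φ₂ j) (A₂ j) (ι₂ j) (θ₂ j))
    (e : (Kf i₁ →+* ℂ) ≃ ZMod 10)
    (he_sign : ∀ s : Kf i₁ →+* ℂ, s.comp i = τ ↔ (e s).val % 2 = 1)
    (he_conj : ∀ s : Kf i₁ →+* ℂ, e (ComplexEmbedding.conjugate s) = e s + 5)
    (he_gal : ∀ g : ZMod 10, ∃ ρ : ℂ ≃+* ℂ, ∀ s : Kf i₁ →+* ℂ, e ((ρ : ℂ →+* ℂ).comp s) = e s + g)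
    (hΦ : ∀ s : Kf i₁ →+* ℂ, s ∈ (Φ₂ 0).1 ↔ (e s).val < 5)
    (hΨ : ∀ σ : Kf i₀ →+* ℂ, σ ∈ (Φ₂ (0 : Fin 1).succ).1 ↔ σ = τ)
    {J : Type} [Fintype J] (cls : J → Fin 2) {X : AbelianVariety ℂ}
    (hX : AbelianVariety.IsIsogenous X (⨁ fun j => A₂ (cls j))) (M : ℕ) :
    HodgeConjectureFor (X.powSucc M).dim (X.powSucc M).X := by
  obtain ⟨n, ρ, hdom⟩ := exists_avDominatedBy_powSucc_biproduct_slots_of_isIsogenous hX M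
  exact hodgeConjectureFor_of_avDominatedBy_comp_of_frame_of_markmanSixfold hM ρ h10 h2 i hd hδ hτ hA e he_sign he_conj
    he_gal hΦ hΨ hdom

end Main

end Summit.HodgeConjecture.CorCM.DecicCurveFivefold

end
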